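import Summits.BirchSwinnertonDyer.BirchSwinnertonDyer.Theses.PrintX9
import Summits.BirchSwinnertonDyer.BirchSwinnertonDyer.Theorems.TorsionLayerDescentAssembly
import Summits.BirchSwinnertonDyer.Rank1Residual.X9.LightFrameSupplyOddOfFriedbergHoffstein
import HarnessLib

/-!
# Route `PrintX9` (rev 7): the K6 leaf `BSDpOnClassX9` from SIX OF ITS OWN ITEMS BY NAME — the two
# any-class-number cruxes r203 `HowardContainmentAnyClassNumber` (stmt-BirchSwinnertonDyer-23161) and
# r204 `TwoSidedLinkAnyClassNumber` (stmt-23162), the μ-inputs `MuTransfer` (19629) and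
# `AnalyticMuZeroX9` (19630), and the two cite-only bundles `HeegnerPrintFactsX9` (20393) /
# `CyclotomicPrintFactsX9` (20532) — WITHOUT crux J `HeegnerDivisibilityX9` (20392) or its children
# `MultiPrimeX9` (22889) / `JetchevPrintFactsX9` (22890): the kernel form of the pen's odd-`d_K`
# reshape (PLAN §7(g)), assembled from the TorsionLayerDescent assembly and the light frame supply

HONEST FRAMING (cell `run/shared/lean/pub/bsd-print-x9/`, D-0131 print tier; typer seat ty3; LEAF file
of the typer tree `Rank1Residual/X9/` importing the two route files it glues — `Theses/PrintX9.lean`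
(rev 7) for the six item decls BY NAME and, through `Theorems/TorsionLayerDescentAssembly.lean`,
`Theses/TorsionLayerDescent.lean` (rev 0) whose assembly it instantiates; theses-cone warnings
acknowledged). THEOREMS ONLY: no definition, no named fact, no `sorry`; NOTHING BOOKED OR EDITED — this
is a TURNKEY for the PrintX9 pen (route verbs are the planner's, D-0059), not a route change: the
route's registered `Assembly` (20531) and `closes` still run through crux J. What the theorem records:
IF the pen re-glues PrintX9 as `HowardContainmentAnyClassNumber → TwoSidedLinkAnyClassNumber →
MuTransfer → AnalyticMuZeroX9 → HeegnerPrintFactsX9 → CyclotomicPrintFactsX9 → BSDpOnClassX9`, that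
assembly is ALREADY a kernel theorem (below), and the `d_K`-even / `p ∣ h_K` / multi-carrier residuals
of crux J (stubs of skeleton v3 on 22889) leave the cone, because the any-class-number Howard road
treats every Tamagawa depth on ONE light frame per pair, supplied in print by Hoffstein–Luo (conjuncts
9–10 of `HeegnerPrintFactsX9`: modularity, `HoffsteinLuo1997_exists_twist_L_one_ne_zero`) through
`TorsionLayer.lightFrameSupplyOdd_of_hoffsteinLuo` (p589032). OPEN inputs BY NAME after this file:
r203, r204 (beyond print: any-`h_K` Λ-adic containment / two-sided link; cell DOSSIER §41), 19629
(`KatoMuTransfer`, kernel modulo Kato's F1), 19630 (`AnalyticMuZeroOnClassX9`, K6 barrier B3); the two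
bundles are cite-only. «beyond-print theorem»: NO (assembly glue). BSD is not proved by any of this;
the leaf does NOT close (four open items).

Mechanism (all landed): `TorsionLayer.torsionLayerDescent_assembly` (p583666: A → B → F → E → D → leaf)
with A, B := PrintX9's r203 / r204 (the same definientia as TorsionLayerDescent's 23161 / 23162, fed
by δ-unfolding), F := `lightFrameSupplyOdd_of_hoffsteinLuo hnf hHL`, E := `IntegralMainConjectureOnClassX9`
from `integralMainConjectureOnClassX9_of_katoMuTransfer hBCS hT hμ` (`Theorems/Rank1ResidualX9MuTransfer.lean`:
BCS 2025 Thm. 1.1.2 (a) + the μ-transfer + analytic μ = 0), D := the eleven print conjuncts picked from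
the two PrintX9 bundles (`HeegnerPrintFactsX9` conjuncts 1, 2, 8, 9, 11, 12; `CyclotomicPrintFactsX9`
conjuncts 1–6).

References: route files `Theses/PrintX9.lean` (rev 7; items 19629, 19630, 20393, 20532, 23161, 23162)
and `Theses/TorsionLayerDescent.lean` (rev 0; assembly 23166); [BurungaleCastellaSkinner2025] Thm.
1.1.2 (a); [HoffsteinLuo1997] Theorem (§1); [JetchevSkinnerWan2017] Thm. 3.3.1; [BCDTJAMS2001] Thm. A.
-/

-- the summit namespace `Summit.BirchSwinnertonDyer.BirchSwinnertonDyer.…` repeats the summit name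
set_option linter.dupNamespace false
set_option autoImplicit false

noncomputable section

namespace Summit.BirchSwinnertonDyer.BirchSwinnertonDyer.Rank1Residual

namespace TorsionLayer

open Summit.BirchSwinnertonDyer.BirchSwinnertonDyer.Theses

/-- **PrintX9's leaf from its any-class-number cruxes, its μ-inputs and its two print bundles — no
crux J.** `HowardContainmentAnyClassNumber → TwoSidedLinkAnyClassNumber → MuTransfer →
AnalyticMuZeroX9 → HeegnerPrintFactsX9 → CyclotomicPrintFactsX9 → BSDpOnClassX9`, every hypothesis a
`route-BirchSwinnertonDyer-PrintX9` item BY NAME (rev 7: r203, r204, 19629, 19630, 20393, 20532).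
[cite: BurungaleCastellaSkinner2025, Thm. 1.1.2 (a)] [cite: HoffsteinLuo1997, Theorem (§1, pp. 435–436)]
[cite: JetchevSkinnerWan2017, Thm. 3.3.1] -/
theorem bsdpOnClassX9_of_anyClassNumberCruxes_of_muInputs_of_printFacts
    (hA : PrintX9.HowardContainmentAnyClassNumber) (hB : PrintX9.TwoSidedLinkAnyClassNumber)
    (hT : PrintX9.MuTransfer) (hμ : PrintX9.AnalyticMuZeroX9)
    (hHP : PrintX9.HeegnerPrintFactsX9) (hCP : PrintX9.CyclotomicPrintFactsX9) :
    Summit.BirchSwinnertonDyer.BirchSwinnertonDyer.Rank1Residual.BSDpOnClassX9 := by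
  obtain ⟨hGZ, hKo, -, -, -, -, -, h331, hnf, hHL, hMaz, hNS⟩ := hHP
  obtain ⟨hBCS, hGr, hGZK, hmod, hpar, h5⟩ := hCP
  exact torsionLayerDescent_assembly hA hB (lightFrameSupplyOdd_of_hoffsteinLuo hnf hHL)
    (integralMainConjectureOnClassX9_of_katoMuTransfer hBCS hT hμ)
    ⟨h331, hGZ, hKo, hGr, hGZK, hmod, hpar, hnf, hMaz, hNS, h5⟩

/-- The same in PrintX9's `Assembly`-item SHAPE with crux J replaced by the two any-class-number
cruxes (the implication a reshaped `Assembly'` item would state), for a `--closes-file` of the form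
`closes (hAsm : Assembly') (hA) (hB) (hT) (hμ) (hHP) (hCP) := hAsm hA hB hT hμ hHP hCP`. -/
theorem printX9_anyClassNumber_assembly :
    PrintX9.HowardContainmentAnyClassNumber → PrintX9.TwoSidedLinkAnyClassNumber → PrintX9.MuTransfer →
      PrintX9.AnalyticMuZeroX9 → PrintX9.HeegnerPrintFactsX9 → PrintX9.CyclotomicPrintFactsX9 →
        Summit.BirchSwinnertonDyer.BirchSwinnertonDyer.Rank1Residual.BSDpOnClassX9 :=
  bsdpOnClassX9_of_anyClassNumberCruxes_of_muInputs_of_printFacts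

end TorsionLayer

end Summit.BirchSwinnertonDyer.BirchSwinnertonDyer.Rank1Residual

end
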